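import Summits.CriticalPhenomena.Ising3DConformalLimit.Theorems.PrecisionLaplacianDirectCorrelationStableTailSlabModeExpDecayDiagLineHolAux5

/-!
# Diagonal line holomorphy, auxiliary file 6: the cosine transforms of the diagonal line function at a
# good transverse momentum are the moments of a positive measure on `[-1, 1]`

Helper file for the sub-stub `stub_slabModeExpDecay_auxDiagLineHol` (brick of `stub_slabModeExpDecay`)
of line `self-energy-pick-inversion`, crux `PrecisionLaplacian.DirectCorrelationStableTail`
(stmt-CriticalPhenomena-4799). Pure theorem file.

**Theorem** (`lineMoments_of_good`, registered sub-goal `stub_slabModeExpDecay_auxDiagLineHol7`). Let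
`q` be an even sub-stochastic step law on `ℤ³`, invariant under `x ↦ (x₁, x₀, -x₂)`, with Green function
`G` positive at the unit vectors, even and invariant under the same map, and suppose the UNIFIED
DIAGONAL MOMENT PROPERTY: for every finite `s ⊂ ℤ²` and `c : ℤ² → ℝ` there is a finite positive
measure `ν` on `[-1, 1]` with
`∑ c_a c_b G(x_a - x_b + n(e₀+e₁)) = ∫ x^{2n} dν` and `∑ c_a c_b G(e₀ - x_a - x_b + n(e₀+e₁)) = ∫ x^{2n+1} dν`
(`x_a = (a₀, -a₀, a₁)`; the spectral measure of the in-plane observable `∑ c_a σ_{x_a}` for the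
symmetric one-step diagonal transfer matrix, files 7–8). Then at every reduced good transverse momentum
`κ₀ ∈ (-π,π)² ∖ {0}` the cosine transforms of the diagonal line function
`γ_{κ₀}(θ) = g(θ + κ₀₀/2, θ - κ₀₀/2, κ₀₁)` are the moments of a finite positive measure on `[-1, 1]`:
`∫_{-π}^{π} cos(mθ) γ_{κ₀}(θ) dθ = ∫ x^m dν_{κ₀}(x)` for all `m : ℕ`.

**Proof.** Localise the unified moment property with the quarter-phase test vectors
`f_N(y) = b_N(y) cos(κ₀·y - κ₀₀/4)` of file 5: by files 4–5 the even forms are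
`(2π)⁻³ ∫ c_{2n} W_N` and the odd forms satisfy `T_N(n+1) + T_N(n) = 2(2π)⁻³ ∫ ẽ_{n+1} C_N`,
`T_N(0) = (2π)⁻³ ∫ ẽ_0 C_N`; dividing by the mass `16^N I_{2N}²` of one squared bump, the bumps at `±κ₀`
each contribute `¼` of the value at `κ₀` (evenness in `k`), the overlaps vanish, and one gets
`∫ x^{2n} dν'_N → ½ c_{2n}(κ₀)`, `∫ x^{2n+1} dν'_N → ½ c_{2n+1}(κ₀)` (induction on `n` from
`ẽ_n = ½(c_{2n+1} + c_{2n-1})`); the moment criterion on `[-1, 1]` (file 2) concludes.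
-/

noncomputable section

namespace Summit.CriticalPhenomena.Ising3DConformalLimit.Cruxes.DirectCorrelationStableTail.SelfEnergyPickInversion

open MeasureTheory Filter Topology Finset Real Literature.Probability.LatticeModels
open scoped BigOperators
open Summit.CriticalPhenomena.Ising3DConformalLimit.Theorems.EtaBoundsTransfer
  (continuous_phase continuous_fourier_q abs_fourier_q_le_one integrableOn_cube_of_continuous
    volume_cube_lt_top)

variable {q : Site 3 → ℝ} {P : ℕ → Site 3 → ℝ}

/-! ### The localisation -/

/-- **The cosine transforms of the diagonal line function at a good transverse momentum are the
moments of a finite positive measure on `[-1, 1]`** (see the module docstring). [folklore] -/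
theorem lineMoments_of_good (hq0 : ∀ y, 0 ≤ q y) (hqs : Summable q) (hq1 : ∑' y, q y ≤ 1)
    (hqev : ∀ y, q (-y) = q y) (hqsym : ∀ x : Site 3, q ![x 1, x 0, -(x 2)] = q x)
    (hP0 : ∀ z, P 0 z = if z = 0 then 1 else 0) (hPs : ∀ j z, P (j + 1) z = ∑' y, q y * P j (z - y))
    {G : Site 3 → ℝ} (hGreen : ∀ z, HasSum (fun j => P j z) (G z)) (hGpos : ∀ m : Fin 3, 0 < G (Pi.single m 1))
    (hGev : ∀ x, G (-x) = G x) (hGsym : ∀ x : Site 3, G ![x 1, x 0, -(x 2)] = G x)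
    (hT : ∀ (s : Finset (Fin 2 → ℤ)) (c : (Fin 2 → ℤ) → ℝ), ∃ ν : Measure ℝ, IsFiniteMeasure ν ∧
      ν (Set.Icc (-1 : ℝ) 1)ᶜ = 0 ∧ ∀ n : ℕ,
        (∑ a ∈ s, ∑ b ∈ s, c a * c b * G ![(a 0 - b 0) + n, -(a 0 - b 0) + n, a 1 - b 1] = ∫ x, x ^ (2 * n) ∂ν) ∧
        (∑ a ∈ s, ∑ b ∈ s, c a * c b * G ![n + 1 - a 0 - b 0, n + a 0 + b 0, -(a 1) - b 1] = ∫ x, x ^ (2 * n + 1) ∂ν))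
    {κ₀ : Fin 2 → ℝ} (hκ₀ : ∀ j, |κ₀ j| < π) (hne : ∃ j, κ₀ j ≠ 0) :
    ∃ ν : Measure ℝ, IsFiniteMeasure ν ∧ ν (Set.Icc (-1 : ℝ) 1)ᶜ = 0 ∧ ∀ m : ℕ,
      ∫ θ in (-π)..π, Real.cos (m * θ) * (1 - ∑' x : Site 3,
        q x * Real.cos (phase 3 ![θ + κ₀ 0 / 2, θ - κ₀ 0 / 2, κ₀ 1] x))⁻¹ = ∫ x, x ^ m ∂ν := by
  have hπ := Real.pi_pos
  set sq := Set.pi Set.univ (fun _ : Fin 2 => Set.Icc (-π) π) with hsq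
  -- goodness of `±κ₀`
  obtain ⟨j₀, hj₀⟩ := hne
  obtain ⟨hgp, hgm, hc1⟩ := good_of_reduced hκ₀ hj₀
  have hkp : ∃ j, ∀ z : ℤ, κ₀ j ≠ z * (2 * π) := ⟨j₀, hgp⟩
  have hkm : ∃ j, ∀ z : ℤ, (-κ₀) j ≠ z * (2 * π) := ⟨j₀, hgm⟩
  have hκ₀' : ∀ j, |(-κ₀) j| < π := fun j => by simpa using hκ₀ j
  -- the line transforms
  set cT : ℕ → (Fin 2 → ℝ) → ℝ := fun m k => ∫ θ in (-π)..π, Real.cos (m * θ) * (1 - ∑' x : Site 3,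
    q x * Real.cos (phase 3 ![θ + k 0 / 2, θ - k 0 / 2, k 1] x))⁻¹ with hcT
  set eT : ℕ → (Fin 2 → ℝ) → ℝ := fun n k => ∫ θ in (-π)..π, Real.cos (2 * n * θ) * Real.cos θ *
    (1 - ∑' x : Site 3, q x * Real.cos (phase 3 ![θ + k 0 / 2, θ - k 0 / 2, k 1] x))⁻¹ with heT
  set eT' : ℕ → (Fin 2 → ℝ) → ℝ := fun n k => (1 / 2) * (cT (2 * n + 1) k + cT (Int.natAbs (2 * n - 1 : ℤ)) k)
    with heT'
  have hcT_int : ∀ m, IntegrableOn (cT m) sq volume := fun m =>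
    integrableOn_lineTransform hq0 hqs hq1 hqev hP0 hPs hGreen hGpos (w := fun θ => Real.cos (m * θ))
      (by fun_prop) (fun θ => Real.abs_cos_le_one _)
  have hcT_cont : ∀ m, ContinuousAt (cT m) κ₀ ∧ ContinuousAt (cT m) (-κ₀) := fun m =>
    ⟨continuousAt_lineTransform hq0 hqs hq1 hP0 hPs hGreen hGpos hkp m,
      continuousAt_lineTransform hq0 hqs hq1 hP0 hPs hGreen hGpos hkm m⟩
  have hcT_neg : ∀ m, cT m (-κ₀) = cT m κ₀ := fun m =>
    lineTransform_neg_momentum hqsym (fun θ => Real.cos (m * θ)) κ₀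
  have heT'_int : ∀ n, IntegrableOn (eT' n) sq volume := fun n =>
    ((hcT_int _).add (hcT_int _)).const_mul _
  have heT'_cont : ∀ n, ContinuousAt (eT' n) κ₀ ∧ ContinuousAt (eT' n) (-κ₀) := fun n =>
    ⟨((hcT_cont _).1.add (hcT_cont _).1).const_mul _, ((hcT_cont _).2.add (hcT_cont _).2).const_mul _⟩
  have heT'_neg : ∀ n, eT' n (-κ₀) = eT' n κ₀ := fun n => by simp only [heT', hcT_neg]
  -- at good momenta `eT = eT'`
  have heq : ∀ (n : ℕ) (k : Fin 2 → ℝ), (∃ j, ∀ z : ℤ, k j ≠ z * (2 * π)) → eT n k = eT' n k := by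
    intro n k hk
    obtain ⟨hpos, hγc⟩ := lineFun_pos_continuous hq0 hqs hq1 hP0 hPs hGreen hGpos hk
    simp only [heT, heT', hcT]
    rw [integral_cos_two_mul_cos_eq]
    congr 1
    simp_rw [add_mul]
    exact intervalIntegral.integral_add ((by fun_prop : Continuous fun θ => Real.cos (((2 * n + 1 : ℕ) : ℝ) * θ) *
      (1 - ∑' x : Site 3, q x * Real.cos (phase 3 ![θ + k 0 / 2, θ - k 0 / 2, k 1] x))⁻¹).intervalIntegrable _ _)
      ((by fun_prop : Continuous fun θ => Real.cos (((Int.natAbs (2 * n - 1 : ℤ) : ℕ) : ℝ) * θ) *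
      (1 - ∑' x : Site 3, q x * Real.cos (phase 3 ![θ + k 0 / 2, θ - k 0 / 2, k 1] x))⁻¹).intervalIntegrable _ _)
  have heq_ae : ∀ n, ∀ᵐ k ∂(volume.restrict sq), eT n k = eT' n k := fun n => by
    filter_upwards [ae_good_momentum] with k hk using heq n k hk
  -- the test data
  set sN : ℕ → Finset (Fin 2 → ℤ) := fun N => Fintype.piFinset (fun _ : Fin 2 => Finset.Icc (-(N : ℤ)) N) with hsN
  set fN : ℕ → (Fin 2 → ℤ) → ℝ := fun N y =>
    (∏ j, ((2 * N).choose (y j + N).toNat : ℝ)) * Real.cos (phase 2 κ₀ y - κ₀ 0 / 4) with hfN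
  choose ν hνfin hν0 hνmom using fun N => hT (sN N) (fN N)
  set TE : ℕ → ℕ → ℝ := fun N n => ∑ a ∈ sN N, ∑ b ∈ sN N, fN N a * fN N b *
    G ![(a 0 - b 0) + n, -(a 0 - b 0) + n, a 1 - b 1] with hTE
  set TO : ℕ → ℕ → ℝ := fun N n => ∑ a ∈ sN N, ∑ b ∈ sN N, fN N a * fN N b *
    G ![n + 1 - a 0 - b 0, n + a 0 + b 0, -(a 1) - b 1] with hTO
  have hTEmom : ∀ N n, TE N n = ∫ x, x ^ (2 * n) ∂(ν N) := fun N n => (hνmom N n).1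
  have hTOmom : ∀ N n, TO N n = ∫ x, x ^ (2 * n + 1) ∂(ν N) := fun N n => (hνmom N n).2
  -- the bumps and the normalisation
  set Bp : ℕ → (Fin 2 → ℝ) → ℝ := fun N k => ∏ j, (2 + 2 * Real.cos ((k + κ₀) j)) ^ N with hBp
  set Bm : ℕ → (Fin 2 → ℝ) → ℝ := fun N k => ∏ j, (2 + 2 * Real.cos ((k - κ₀) j)) ^ N with hBm
  set Z : ℕ → ℝ := fun N => 16 ^ N * (∫ t in (-π)..π, (1 + Real.cos t) ^ (2 * N)) ^ 2 with hZ
  have hZpos : ∀ N, 0 < Z N := fun N => by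
    have := vp_integral_pos (2 * N); simp only [hZ]; positivity
  -- bounds and continuity of the bumps
  have hBcont : ∀ (N : ℕ) (κ : Fin 2 → ℝ), Continuous fun k : Fin 2 → ℝ => ∏ j, (2 + 2 * Real.cos ((k + κ) j)) ^ N :=
    fun N κ => by fun_prop
  have hBbd : ∀ (N : ℕ) (κ k : Fin 2 → ℝ), |∏ j, (2 + 2 * Real.cos ((k + κ) j)) ^ N| ≤ 16 ^ N := by
    intro N κ k
    rw [abs_of_nonneg (Finset.prod_nonneg fun j _ => pow_nonneg (by linarith [Real.neg_one_le_cos ((k + κ) j)]) N),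
      Fin.prod_univ_two, show (16 : ℝ) ^ N = 4 ^ N * 4 ^ N by rw [← mul_pow]; norm_num]
    have h4 : ∀ j, (2 + 2 * Real.cos ((k + κ) j)) ^ N ≤ 4 ^ N := fun j =>
      pow_le_pow_left₀ (by linarith [Real.neg_one_le_cos ((k + κ) j)]) (by linarith [Real.cos_le_one ((k + κ) j)]) N
    exact mul_le_mul (h4 0) (h4 1) (pow_nonneg (by linarith [Real.neg_one_le_cos ((k + κ) 1)]) N) (by positivity)
  have hBp_eq : ∀ N k, Bp N k = ∏ j, (2 + 2 * Real.cos ((k + κ₀) j)) ^ N := fun N k => rfl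
  have hBm_eq : ∀ N k, Bm N k = ∏ j, (2 + 2 * Real.cos ((k + (-κ₀)) j)) ^ N := fun N k => by
    simp only [hBm, ← sub_eq_add_neg]
  -- integrable products `h · (bounded continuous)` over the zone
  have hmul : ∀ {h : (Fin 2 → ℝ) → ℝ} {g : (Fin 2 → ℝ) → ℝ} (C : ℝ), IntegrableOn h sq volume → Continuous g →
      (∀ k, |g k| ≤ C) → IntegrableOn (fun k => h k * g k) sq volume := by
    intro h g C hh hg hb
    exact hh.mul_bdd hg.aestronglyMeasurable (Eventually.of_forall fun k => by rw [Real.norm_eq_abs]; exact hb k)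
  -- the three limit shapes, for an admissible `h`
  have hlim : ∀ {h : (Fin 2 → ℝ) → ℝ}, IntegrableOn h sq volume → ContinuousAt h κ₀ → ContinuousAt h (-κ₀) →
      h (-κ₀) = h κ₀ → ∀ {w : (Fin 2 → ℝ) → ℝ}, Continuous w → (∀ k, |w k| ≤ 1) → w κ₀ = 1 →
      ∀ {w' : (Fin 2 → ℝ) → ℝ}, Continuous w' → (∀ k, |w' k| ≤ 1) → w' (-κ₀) = 1 →
      ∀ {w'' : (Fin 2 → ℝ) → ℝ}, Continuous w'' → (∀ k, |w'' k| ≤ 1) →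
      Tendsto (fun N => (∫ k in sq, h k * ((1 / 4) * (w' k * Bp N k ^ 2 + w k * Bm N k ^ 2) +
        (1 / 2) * w'' k * (Bp N k * Bm N k))) / Z N) atTop (𝓝 ((1 / 2) * h κ₀)) := by
    intro h hh hc hc' hev w hw hw1 hwκ w' hw' hw'1 hw'κ w'' hw'' hw''1
    -- the three pieces
    have i1 : ∀ N, IntegrableOn (fun k => (h k * w' k) * Bp N k ^ 2) sq volume := fun N =>
      hmul ((16 ^ N) ^ 2) (hmul 1 hh hw' hw'1) ((hBcont N κ₀).pow 2) fun k => by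
        rw [abs_pow]; exact pow_le_pow_left₀ (abs_nonneg _) (hBbd N κ₀ k) 2
    have i2 : ∀ N, IntegrableOn (fun k => (h k * w k) * Bm N k ^ 2) sq volume := fun N => by
      simp_rw [hBm_eq]
      exact hmul ((16 ^ N) ^ 2) (hmul 1 hh hw hw1) ((hBcont N (-κ₀)).pow 2) fun k => by
        rw [abs_pow]; exact pow_le_pow_left₀ (abs_nonneg _) (hBbd N (-κ₀) k) 2
    have i3 : ∀ N, IntegrableOn (fun k => (h k * w'' k) * (Bp N k * Bm N k)) sq volume := fun N => by
      simp_rw [hBm_eq]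
      exact hmul (16 ^ N * 16 ^ N) (hmul 1 hh hw'' hw''1) ((hBcont N κ₀).mul (hBcont N (-κ₀))) fun k => by
        rw [abs_mul]; exact mul_le_mul (hBbd N κ₀ k) (hBbd N (-κ₀) k) (abs_nonneg _) (by positivity)
    -- limits of the pieces
    have l1 : Tendsto (fun N => (∫ k in sq, (h k * w' k) * Bp N k ^ 2) / Z N) atTop (𝓝 (h κ₀)) := by
      have hcont1 : ContinuousAt (fun k => h k * w' k) (-κ₀) := hc'.mul hw'.continuousAt
      have := tendsto_bumpSq_localise (hmul 1 hh hw' hw'1) hκ₀' hcont1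
      simp only [hev, hw'κ, mul_one] at this
      refine this.congr fun N => ?_
      simp only [hZ, hBp, hsq, sub_neg_eq_add]
    have l2 : Tendsto (fun N => (∫ k in sq, (h k * w k) * Bm N k ^ 2) / Z N) atTop (𝓝 (h κ₀)) := by
      have hcont2 : ContinuousAt (fun k => h k * w k) κ₀ := hc.mul hw.continuousAt
      have := tendsto_bumpSq_localise (hmul 1 hh hw hw1) hκ₀ hcont2
      simp only [hwκ, mul_one] at this
      refine this.congr fun N => ?_
      simp only [hZ, hBm, hsq]
    have l3 : Tendsto (fun N => (∫ k in sq, (h k * w'' k) * (Bp N k * Bm N k)) / Z N) atTop (𝓝 0) := by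
      have := tendsto_overlap_integral (hmul 1 hh hw'' hw''1) (κ₀ := κ₀) hc1
      refine this.congr fun N => ?_
      simp only [hZ, hBp, hBm, hsq]
    have hsum := ((l1.const_mul (1 / 4)).add (l2.const_mul (1 / 4))).add (l3.const_mul (1 / 2))
    rw [show (1 / 4 : ℝ) * h κ₀ + 1 / 4 * h κ₀ + 1 / 2 * 0 = 1 / 2 * h κ₀ by ring] at hsum
    refine hsum.congr fun N => ?_
    rw [mul_div_assoc', mul_div_assoc', mul_div_assoc', ← add_div, ← add_div]
    congr 1
    rw [← integral_const_mul, ← integral_const_mul, ← integral_const_mul,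
      ← integral_add ((i1 N).const_mul _) ((i2 N).const_mul _)]
    have hAB : Integrable (fun k => 1 / 4 * (h k * w' k * Bp N k ^ 2) + 1 / 4 * (h k * w k * Bm N k ^ 2))
        (volume.restrict sq) := ((i1 N).const_mul _).add ((i2 N).const_mul _)
    rw [← integral_add hAB ((i3 N).const_mul _)]
    exact integral_congr_ae (ae_of_all _ fun k => by ring)
  -- the expanded weights
  have hW : ∀ N k, ∑ a ∈ sN N, ∑ b ∈ sN N, fN N a * fN N b * Real.cos (phase 2 k (a - b)) =
      (1 / 4) * (Bp N k ^ 2 + Bm N k ^ 2) + (1 / 2) * Real.cos (κ₀ 0 / 2) * (Bp N k * Bm N k) := by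
    intro N k; simp only [hfN, hsN, hBp, hBm]; exact testWeight_eq N κ₀ k
  have hC : ∀ N k, ∑ a ∈ sN N, ∑ b ∈ sN N, fN N a * fN N b * Real.cos (k 0 / 2 - phase 2 k (a + b)) =
      (1 / 4) * (Real.cos ((k 0 - κ₀ 0) / 2) * Bm N k ^ 2 + Real.cos ((k 0 + κ₀ 0) / 2) * Bp N k ^ 2) +
        (1 / 2) * Real.cos (k 0 / 2) * (Bp N k * Bm N k) := by
    intro N k; simp only [hfN, hsN, hBp, hBm]; exact crossWeight_eq N κ₀ k
  -- casts of the line transforms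
  have hcT2 : ∀ (n : ℕ) (k : Fin 2 → ℝ), (∫ θ in (-π)..π, Real.cos (2 * n * θ) * (1 - ∑' x : Site 3,
      q x * Real.cos (phase 3 ![θ + k 0 / 2, θ - k 0 / 2, k 1] x))⁻¹) = cT (2 * n) k := by
    intro n k; simp only [hcT]; push_cast; rfl
  -- a uniform bound for weights of the three-bump shape
  have hbd3 : ∀ (N : ℕ) (c₁ c₂ c₃ : ℝ) (k : Fin 2 → ℝ), |c₁| ≤ 1 → |c₂| ≤ 1 → |c₃| ≤ 1 →
      |(1 / 4) * (c₁ * Bp N k ^ 2 + c₂ * Bm N k ^ 2) + (1 / 2) * c₃ * (Bp N k * Bm N k)| ≤ (16 ^ N) ^ 2 := by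
    intro N c₁ c₂ c₃ k h1 h2 h3
    have hp := hBbd N κ₀ k; have hm := hBbd N (-κ₀) k
    rw [← hBp_eq] at hp; rw [← hBm_eq] at hm
    set X := Bp N k ^ 2 with hXd
    set Y := Bm N k ^ 2 with hYd
    have hX0 : 0 ≤ X := sq_nonneg _
    have hY0 : 0 ≤ Y := sq_nonneg _
    have hXle : X ≤ (16 ^ N) ^ 2 := by rw [hXd, ← sq_abs]; exact pow_le_pow_left₀ (abs_nonneg _) hp 2
    have hYle : Y ≤ (16 ^ N) ^ 2 := by rw [hYd, ← sq_abs]; exact pow_le_pow_left₀ (abs_nonneg _) hm 2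
    have hWle : |Bp N k * Bm N k| ≤ (X + Y) / 2 := by
      rw [abs_mul, hXd, hYd, ← sq_abs (Bp N k), ← sq_abs (Bm N k)]
      linarith [two_mul_le_add_sq (|Bp N k|) (|Bm N k|)]
    have e1 : |c₁ * X| ≤ X := by
      rw [abs_mul, abs_of_nonneg hX0]; exact mul_le_of_le_one_left hX0 h1
    have e2 : |c₂ * Y| ≤ Y := by
      rw [abs_mul, abs_of_nonneg hY0]; exact mul_le_of_le_one_left hY0 h2
    have e3 : |c₃ * (Bp N k * Bm N k)| ≤ (X + Y) / 2 := by
      rw [abs_mul]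
      calc |c₃| * |Bp N k * Bm N k| ≤ 1 * ((X + Y) / 2) :=
            mul_le_mul h3 hWle (abs_nonneg _) zero_le_one
        _ = (X + Y) / 2 := one_mul _
    calc |(1 / 4) * (c₁ * X + c₂ * Y) + (1 / 2) * c₃ * (Bp N k * Bm N k)|
        ≤ |(1 / 4) * (c₁ * X + c₂ * Y)| + |(1 / 2) * c₃ * (Bp N k * Bm N k)| := abs_add_le _ _
      _ = (1 / 4) * |c₁ * X + c₂ * Y| + (1 / 2) * |c₃ * (Bp N k * Bm N k)| := by
          rw [abs_mul, mul_assoc (1 / 2 : ℝ), abs_mul (1 / 2 : ℝ), abs_of_pos (by norm_num : (0 : ℝ) < 1 / 4),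
            abs_of_pos (by norm_num : (0 : ℝ) < 1 / 2)]
      _ ≤ (1 / 4) * (X + Y) + (1 / 2) * ((X + Y) / 2) := by
          have := abs_add_le (c₁ * X) (c₂ * Y)
          nlinarith [e1, e2, e3]
      _ ≤ (16 ^ N) ^ 2 := by linarith
  -- (I1) the even forms
  have hI1 : ∀ N n, (2 * π) ^ 3 * TE N n = ∫ k in sq, cT (2 * n) k *
      ((1 / 4) * ((fun _ => (1 : ℝ)) k * Bp N k ^ 2 + (fun _ => (1 : ℝ)) k * Bm N k ^ 2) +
        (1 / 2) * (fun _ => Real.cos (κ₀ 0 / 2)) k * (Bp N k * Bm N k)) := by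
    intro N n
    have h := diagForm_eq_integral hq0 hqs hq1 hqev hqsym hP0 hPs hGreen hGpos (sN N) (fN N) n
    simp only [hTE]
    rw [h]
    refine integral_congr_ae (ae_of_all _ fun k => ?_)
    simp only [hcT2, hW, one_mul]
  have hLE : ∀ n, Tendsto (fun N => (2 * π) ^ 3 * TE N n / Z N) atTop (𝓝 ((1 / 2) * cT (2 * n) κ₀)) := by
    intro n
    have h := hlim (hcT_int (2 * n)) (hcT_cont (2 * n)).1 (hcT_cont (2 * n)).2 (hcT_neg (2 * n))
      (w := fun _ => (1 : ℝ)) continuous_const (fun _ => by simp) rfl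
      (w' := fun _ => (1 : ℝ)) continuous_const (fun _ => by simp) rfl
      (w'' := fun _ => Real.cos (κ₀ 0 / 2)) continuous_const (fun _ => Real.abs_cos_le_one _)
    refine h.congr fun N => ?_
    rw [hI1]
  -- (I2) the two-slab forms and the odd recursion
  set X : ℕ → ℕ → ℝ := fun N n => ∑ a ∈ sN N, ∑ b ∈ sN N, fN N a * fN N b *
    G ![n - 1 + a 0 + b 0, n - a 0 - b 0, a 1 + b 1] with hX
  have hX0 : ∀ N, X N 0 = TO N 0 := by
    intro N
    simp only [hX, hTO]
    refine Finset.sum_congr rfl fun a _ => Finset.sum_congr rfl fun b _ => ?_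
    congr 1
    rw [← hGev]
    congr 1; ext j; fin_cases j <;> simp
    all_goals ring
  have hXs : ∀ N n, X N (n + 1) = TO N n := by
    intro N n
    simp only [hX, hTO]
    refine Finset.sum_congr rfl fun a _ => Finset.sum_congr rfl fun b _ => ?_
    congr 1
    rw [← hGsym]
    congr 1; ext j; fin_cases j <;> simp
    all_goals ring
  have hI2 : ∀ N n, (2 * π) ^ 3 * (TO N n + X N n) = 2 * ∫ k in sq, eT' n k *
      ((1 / 4) * ((fun k : Fin 2 → ℝ => Real.cos ((k 0 + κ₀ 0) / 2)) k * Bp N k ^ 2 +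
        (fun k : Fin 2 → ℝ => Real.cos ((k 0 - κ₀ 0) / 2)) k * Bm N k ^ 2) +
        (1 / 2) * (fun k : Fin 2 → ℝ => Real.cos (k 0 / 2)) k * (Bp N k * Bm N k)) := by
    intro N n
    have h := twoSlab_form_eq_integral hq0 hqs hq1 hqev hqsym hP0 hPs hGreen hGpos (sN N) (fN N) (fN N) n
    have hdbl : ∀ (g : (Fin 2 → ℤ) → (Fin 2 → ℤ) → ℝ), ∑ a ∈ sN N, ∑ b ∈ sN N,
        (fN N a * fN N b + fN N a * fN N b) * g a b = 2 * ∑ a ∈ sN N, ∑ b ∈ sN N, fN N a * fN N b * g a b := by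
      intro g
      rw [Finset.mul_sum]
      refine Finset.sum_congr rfl fun a _ => ?_
      rw [Finset.mul_sum]
      exact Finset.sum_congr rfl fun b _ => by ring
    simp only [hdbl, hcT2, hW, hC] at h
    -- `h : (2π)³ (2 TE + TO + X) = ∫ (cT · 2W + eT · 2C)`
    have hTE' : (2 * π) ^ 3 * TE N n = ∫ k in sq, cT (2 * n) k *
        ((1 / 4) * (Bp N k ^ 2 + Bm N k ^ 2) + (1 / 2) * Real.cos (κ₀ 0 / 2) * (Bp N k * Bm N k)) := by
      rw [hI1]; simp only [one_mul]
    -- integrability of the two halves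
    have iW : IntegrableOn (fun k => cT (2 * n) k *
        ((1 / 4) * (Bp N k ^ 2 + Bm N k ^ 2) + (1 / 2) * Real.cos (κ₀ 0 / 2) * (Bp N k * Bm N k))) sq volume :=
      hmul ((16 ^ N) ^ 2) (hcT_int (2 * n)) (by simp only [hBp_eq, hBm_eq]; fun_prop) fun k => by
        simpa only [one_mul] using hbd3 N 1 1 (Real.cos (κ₀ 0 / 2)) k (by simp) (by simp) (Real.abs_cos_le_one _)
    have iC : IntegrableOn (fun k => eT' n k * ((1 / 4) * (Real.cos ((k 0 + κ₀ 0) / 2) * Bp N k ^ 2 +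
        Real.cos ((k 0 - κ₀ 0) / 2) * Bm N k ^ 2) + (1 / 2) * Real.cos (k 0 / 2) * (Bp N k * Bm N k))) sq volume :=
      hmul ((16 ^ N) ^ 2) (heT'_int n) (by simp only [hBp_eq, hBm_eq]; fun_prop) fun k =>
        hbd3 N _ _ _ k (Real.abs_cos_le_one _) (Real.abs_cos_le_one _) (Real.abs_cos_le_one _)
    have hEt : ∀ k : Fin 2 → ℝ, (∫ θ in (-π)..π, Real.cos (2 * n * θ) * Real.cos θ * (1 - ∑' x : Site 3,
        q x * Real.cos (phase 3 ![θ + k 0 / 2, θ - k 0 / 2, k 1] x))⁻¹) = eT n k := fun k => rfl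
    simp only [hEt] at h
    -- integrability of the two halves of the integrand of `h`
    have iW2 : IntegrableOn (fun k => cT (2 * n) k * (2 * ((1 / 4) * (Bp N k ^ 2 + Bm N k ^ 2) +
        (1 / 2) * Real.cos (κ₀ 0 / 2) * (Bp N k * Bm N k)))) sq volume :=
      (iW.const_mul 2).congr (ae_of_all _ fun k => by ring)
    have iC2 : IntegrableOn (fun k => eT n k * (2 * ((1 / 4) * (Real.cos ((k 0 - κ₀ 0) / 2) * Bm N k ^ 2 +
        Real.cos ((k 0 + κ₀ 0) / 2) * Bp N k ^ 2) + (1 / 2) * Real.cos (k 0 / 2) * (Bp N k * Bm N k)))) sq volume := by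
      refine (iC.const_mul 2).congr ?_
      filter_upwards [heq_ae n] with k hk
      rw [hk]; ring
    rw [integral_add iW2 iC2] at h
    have hC' : ∫ k in sq, eT n k * (2 * ((1 / 4) * (Real.cos ((k 0 - κ₀ 0) / 2) * Bm N k ^ 2 +
        Real.cos ((k 0 + κ₀ 0) / 2) * Bp N k ^ 2) + (1 / 2) * Real.cos (k 0 / 2) * (Bp N k * Bm N k))) =
        2 * ∫ k in sq, eT' n k * ((1 / 4) * (Real.cos ((k 0 + κ₀ 0) / 2) * Bp N k ^ 2 +
        Real.cos ((k 0 - κ₀ 0) / 2) * Bm N k ^ 2) + (1 / 2) * Real.cos (k 0 / 2) * (Bp N k * Bm N k)) := by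
      rw [← integral_const_mul]
      refine integral_congr_ae ?_
      filter_upwards [heq_ae n] with k hk
      rw [hk]; ring
    have hW' : ∫ k in sq, cT (2 * n) k * (2 * ((1 / 4) * (Bp N k ^ 2 + Bm N k ^ 2) +
        (1 / 2) * Real.cos (κ₀ 0 / 2) * (Bp N k * Bm N k))) = 2 * ((2 * π) ^ 3 * TE N n) := by
      rw [hTE', ← integral_const_mul]
      exact integral_congr_ae (ae_of_all _ fun k => by ring)
    rw [hC', hW'] at h
    simp only
    linarith
  have hLO' : ∀ n, Tendsto (fun N => (2 * π) ^ 3 * (TO N n + X N n) / Z N) atTop (𝓝 (eT' n κ₀)) := by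
    intro n
    have h := hlim (heT'_int n) (heT'_cont n).1 (heT'_cont n).2 (heT'_neg n)
      (w := fun k : Fin 2 → ℝ => Real.cos ((k 0 - κ₀ 0) / 2)) (by fun_prop) (fun _ => Real.abs_cos_le_one _) (by simp)
      (w' := fun k : Fin 2 → ℝ => Real.cos ((k 0 + κ₀ 0) / 2)) (by fun_prop) (fun _ => Real.abs_cos_le_one _) (by simp)
      (w'' := fun k : Fin 2 → ℝ => Real.cos (k 0 / 2)) (by fun_prop) (fun _ => Real.abs_cos_le_one _)
    have h2 := h.const_mul 2
    rw [show (2 : ℝ) * (1 / 2 * eT' n κ₀) = eT' n κ₀ by ring] at h2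
    refine h2.congr fun N => ?_
    rw [hI2, mul_div_assoc]
  -- the odd forms by induction
  have he0 : eT' 0 κ₀ = cT 1 κ₀ := by
    simp only [heT']; norm_num; ring
  have hes : ∀ n : ℕ, eT' (n + 1) κ₀ = (1 / 2) * (cT (2 * n + 3) κ₀ + cT (2 * n + 1) κ₀) := by
    intro n
    simp only [heT']
    rw [show Int.natAbs (2 * ((n + 1 : ℕ) : ℤ) - 1) = 2 * n + 1 by omega, show 2 * (n + 1) + 1 = 2 * n + 3 by ring]
  have hLO : ∀ n, Tendsto (fun N => (2 * π) ^ 3 * TO N n / Z N) atTop (𝓝 ((1 / 2) * cT (2 * n + 1) κ₀)) := by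
    intro n
    induction n with
    | zero =>
      have h := (hLO' 0).const_mul (1 / 2)
      rw [he0] at h
      refine h.congr fun N => ?_
      rw [hX0]; ring
    | succ n ih =>
      have h := (hLO' (n + 1)).sub ih
      rw [hes, show (1 : ℝ) / 2 * (cT (2 * n + 3) κ₀ + cT (2 * n + 1) κ₀) - 1 / 2 * cT (2 * n + 1) κ₀ =
        1 / 2 * cT (2 * (n + 1) + 1) κ₀ by ring_nf] at h
      refine h.congr fun N => ?_
      rw [hXs]; ring
  -- the rescaled measures and their moments
  have hcN : ∀ N, 0 ≤ (2 * π) ^ 3 / Z N := fun N => (div_pos (by positivity) (hZpos N)).le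
  set ν' : ℕ → Measure ℝ := fun N => ((2 * π) ^ 3 / Z N).toNNReal • ν N with hν'
  have hfin' : ∀ N, IsFiniteMeasure (ν' N) := fun N => by
    haveI := hνfin N; simp only [hν']; infer_instance
  have hν'0 : ∀ N, ν' N (Set.Icc (-1 : ℝ) 1)ᶜ = 0 := fun N => by
    simp only [hν', Measure.smul_apply, hν0 N, smul_zero]
  have hmom' : ∀ N m, ∫ x, x ^ m ∂(ν' N) = (2 * π) ^ 3 / Z N * ∫ x, x ^ m ∂(ν N) := fun N m => by
    simp only [hν']
    rw [integral_smul_nnreal_measure, NNReal.smul_def, smul_eq_mul, Real.coe_toNNReal _ (hcN N)]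
  have hlimall : ∀ m, Tendsto (fun N => ∫ x, x ^ m ∂(ν' N)) atTop (𝓝 ((1 / 2) * cT m κ₀)) := by
    intro m
    obtain ⟨n, rfl | rfl⟩ := Nat.even_or_odd' m
    · refine (hLE n).congr fun N => ?_
      rw [hmom', ← hTEmom]; ring
    · refine (hLO n).congr fun N => ?_
      rw [hmom', ← hTOmom]; ring
  obtain ⟨M, hM⟩ := (hlimall 0).bddAbove_range
  have hle : ∀ N n, n ≤ N → ∫ x, x ^ (2 * n) ∂(ν' N) ≤ M := fun N n _ => by
    haveI := hfin' N
    exact (integrable_pow_of_Icc_neg_one (hν'0 N) n).2.trans (hM ⟨N, rfl⟩)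
  obtain ⟨μ, hμfin, hμ0, hμmom⟩ := exists_measure_Icc_neg_one_of_momentLimit (fun m => (1 / 2) * cT m κ₀) ν'
    hfin' (fun N m => by haveI := hfin' N; exact (integrable_pow_of_Icc_neg_one (hν'0 N) m).1) hle hlimall
  refine ⟨(2 : NNReal) • μ, inferInstance, by rw [Measure.smul_apply, hμ0, smul_zero], fun m => ?_⟩
  rw [integral_smul_nnreal_measure, ← hμmom m, NNReal.smul_def, smul_eq_mul]
  show cT m κ₀ = _
  push_cast
  ring

/-- **Registered auxiliary stub `stub_slabModeExpDecay_auxDiagLineHol7`** (sub-goal of the brick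
`stub_slabModeExpDecay_auxDiagLineHol` of `stub_slabModeExpDecay`): the cosine transforms of the
diagonal line function at a good transverse momentum are the moments of a finite positive measure on
`[-1, 1]`, given the unified diagonal moment property (`lineMoments_of_good`). [folklore] -/
theorem stub_slabModeExpDecay_auxDiagLineHol7 : ∀ (q : Site 3 → ℝ) (P : ℕ → Site 3 → ℝ) (G : Site 3 → ℝ), (∀ y, 0 ≤ q y) → Summable q → ∑' y, q y ≤ 1 → (∀ y, q (-y) = q y) → (∀ x : Site 3, q ![x 1, x 0, -(x 2)] = q x) → (∀ z, P 0 z = if z = 0 then 1 else 0) → (∀ j z, P (j + 1) z = ∑' y, q y * P j (z - y)) → (∀ z, HasSum (fun j => P j z) (G z)) → (∀ m : Fin 3, 0 < G (Pi.single m 1)) → (∀ x, G (-x) = G x) → (∀ x : Site 3, G ![x 1, x 0, -(x 2)] = G x) → (∀ (s : Finset (Fin 2 → ℤ)) (c : (Fin 2 → ℤ) → ℝ), ∃ ν : MeasureTheory.Measure ℝ, MeasureTheory.IsFiniteMeasure ν ∧ ν (Set.Icc (-1 : ℝ) 1)ᶜ = 0 ∧ ∀ n : ℕ, (∑ a ∈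 s, ∑ b ∈ s, c a * c b * G ![(a 0 - b 0) + n, -(a 0 - b 0) + n, a 1 - b 1] = ∫ x, x ^ (2 * n) ∂ν) ∧ (∑ a ∈ s, ∑ b ∈ s, c a * c b * G ![n + 1 - a 0 - b 0, n + a 0 + b 0, -(a 1) - b 1] = ∫ x, x ^ (2 * n + 1) ∂ν)) → ∀ (κ₀ : Fin 2 → ℝ), (∀ j, |κ₀ j| < Real.pi) → (∃ j, κ₀ j ≠ 0) → ∃ ν : MeasureTheory.Measure ℝ, MeasureTheory.IsFiniteMeasure ν ∧ ν (Set.Icc (-1 : ℝ) 1)ᶜ = 0 ∧ ∀ m : ℕ, ∫ θ in (-Real.pi)..Real.pi, Real.cos (m * θ) * (1 - ∑' x : Site 3, q x * Real.cos (phase 3 ![θ + κ₀ 0 / 2, θ - κ₀ 0 / 2, κ₀ 1] x))⁻¹ = ∫ x, x ^ m ∂ν :=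
  fun _ _ _ hq0 hqs hq1 hqev hqsym hP0 hPs hGreen hGpos hGev hGsym hT _ hκ₀ hne =>
    lineMoments_of_good hq0 hqs hq1 hqev hqsym hP0 hPs hGreen hGpos hGev hGsym hT hκ₀ hne

end Summit.CriticalPhenomena.Ising3DConformalLimit.Cruxes.DirectCorrelationStableTail.SelfEnergyPickInversion

end
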